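import Summits.AnomalousDissipation.AnomalousDissipation.Statement
import Summits.AnomalousDissipation.AnomalousDissipation.Theorems.SoloInformedLiouvilleModes
import Summits.AnomalousDissipation.AnomalousDissipation.Theorems.SoloInformedLiouvilleData
import Literature.Analysis.FluidPDE.TwoHalfNavierStokes
import Literature.Analysis.FluidPDE.TorusClassicalLerayHopfProofs
import Literature.Analysis.FluidPDE.PassiveScalarClassicalEnergy
import Literature.Analysis.FluidPDE.GalerkinEnergyBalanceLongTime
import HarnessLib

/-!
# Liouville laminar states: unbounded mean enstrophy at bounded mean energy (solo-informed)

A necessary condition for the zeroth law `AnomalousDissipation` (= `Literature.Turb.ZerothLaw`: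
ONE smooth steady force, `ν_j → 0`, Leray–Hopf solutions with bounded mean energy and mean
dissipation `ν_j⟨‖∇u_j‖₂²⟩ ≥ ε > 0`) is that the mean ENSTROPHY `⟨‖∇u_j‖₂²⟩ = ε_j/ν_j` be
unbounded at bounded mean energy.  This file shows, sorry-free, that this weaker property is
realised by LAMINAR, LINEAR, exactly steady states — so it carries no cascade content:

**Theorem** (`exists_steadyStates_unboundedEnstrophy`,
`exists_lerayHopf_unboundedMeanEnstrophy`).  There are one smooth, divergence-free, mean-zero
force `f` on `T³`, viscosities `ν_n > 0`, `ν_n → 0`, and smooth steady classical solutions `U_n`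
of `NS_{ν_n} + f` with `sup_n ∫‖U_n‖² < ∞` and `‖∇U_n‖₂² → ∞`; as constant-in-time global
Leray–Hopf solutions, `sup_n meanEnergy < ∞` and `meanDissipation(ν_n, U_n)/ν_n → ∞`.

**Construction** (`2½`-dimensional, `Torus.isClassicalNSSolutionOn_twoHalf`).
`U_ν = (c, R_ν) ∘ π` with a CONSTANT planar drift `c = (-θ, 1)`, `θ = liouvilleNumber 2`, and a
planar scalar `R_ν` solving the steady drift–diffusion equation `c·∇R_ν - νΔR_ν = h`; then
`(U·∇)U = (0, c·∇R_ν) ∘ π`, `ΔU = (0, ΔR_ν) ∘ π`, so `U_ν` is an exact steady solution with the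
`ν`-independent force `f = (0, h) ∘ π` and zero pressure.  Mode by mode
(`M_k(z)(y) = Re (z e_k(y))`, `e_k(y) = e^{2πi k·y}`): `(c·∇ - νΔ) M_k(z) = M_k((2πi c·k + 4π²ν|k|²) z)`.
The force is `h = ∑_n M_{k_n}(w_n)` on the Liouville resonant frequencies
`k_n = (b_n, a_n)`, `b_n = 2^{(n+2)!}`, `a_n/b_n` the `(n+2)`-nd partial sum of `θ`, where the
drift symbol `c·k_n = -(b_n θ - a_n) = -s_n` is positive but super-exponentially small,
`0 < s_n < b_n^{-(n+1)}` (Mathlib `LiouvilleNumber.remainder_pos/remainder_lt`), with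
amplitudes `w_n = 2π s_n 2^{-n}`, so `h` is `C^∞` (`∑_n w_n (1+|k_n|²)^m < ∞` for every `m`).
The response `z_n(ν) = w_n/(iσ_n + νλ_n)`, `σ_n = -2π s_n`, `λ_n = 4π²|k_n|²`, has
`|z_n(ν)| ≤ w_n/|σ_n| = 2^{-n}` for EVERY `ν` (bounded energy, `|R_ν| ≤ 2` pointwise), while at
`ν_n = |σ_n|/λ_n` the `n`-th mode alone gives `‖∇U‖₂² ≥ π²|k_n|²|z_n|² = π² b_n² 4^{-n}/2 → ∞`
(one Fourier coefficient and Bessel's inequality; `b_n ≥ 4^{n+1}`).  Small divisors of a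
Liouville drift direction turn the force's own exponentially small high modes into unbounded
gradients; a Diophantine drift would keep the enstrophy bounded.

References: J. Liouville (1851) / Mathlib `LiouvilleNumber`; A. Cheskidov, arXiv:2311.04182 §3, §6
and E. Bruè, C. De Lellis, CMP 400 (2023) §3 (the `2½`-dimensional ansatz) [Cheskidov2023,
BrueDeLellis2023]; L. Grafakos, *Classical Fourier Analysis* (2014) Prop. 3.2.6–3.3.12
[Grafakos2014]; J. C. Robinson, J. L. Rodrigo, W. Sadowski (2016) Thm. 6.5
[RobinsonRodrigoSadowski2016].
-/

noncomputable section

open MeasureTheory Filter Topology Set UnitAddTorus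
open scoped ENNReal NNReal InnerProductSpace Real ComplexConjugate

namespace Summit.AnomalousDissipation.AnomalousDissipation.Theorems

open Literature.Analysis.FunctionSpaces Literature.Analysis.FunctionSpaces.Torus
  Literature.Analysis.FluidPDE

/-! ## The planar force profile and the laminar response -/

section Planar

/-- The flat two-torus (local notation). -/
local notation "𝕋²" => UnitAddTorus (Fin 2)
/-- `ℝ²` (local notation). -/
local notation "E²" => EuclideanSpace ℝ (Fin 2)

/-- The planar force profile `h = ∑_n M_{k_n}(w_n)` (smooth, mean zero). [folklore] -/
def hL : 𝕋² → ℝ := modeSeries kL (fun n => (wL n : ℂ))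

/-- The laminar response `R_ν = ∑_n M_{k_n}(z_n(ν))`. [folklore] -/
def RL (ν : ℝ) : 𝕋² → ℝ := modeSeries kL (zL ν)

/-- The force coefficients decay rapidly. [folklore] -/
theorem rapidDecay_wL : RapidDecay kL (fun n => (wL n : ℂ)) := summable_wL_weight

/-- The response coefficients decay rapidly (`ν > 0`). [folklore] -/
theorem rapidDecay_zL {ν : ℝ} (hν : 0 < ν) : RapidDecay kL (zL ν) := summable_zL_weight hν

/-- The force profile `h` is smooth. [folklore] -/
theorem isSmooth_hL : IsSmooth hL := rapidDecay_wL.isSmooth_modeSeries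

/-- The response `R_ν` is smooth (`ν > 0`). [folklore] -/
theorem isSmooth_RL {ν : ℝ} (hν : 0 < ν) : IsSmooth (RL ν) := (rapidDecay_zL hν).isSmooth_modeSeries

/-- The force profile `h` has zero mean. [folklore] -/
theorem hasZeroMean_hL : HasZeroMean hL :=
  hasZeroMean_modeSeries rapidDecay_wL.summable_norm kL_ne_zero

/-- **Uniform pointwise bound** `|R_ν| ≤ 2` (all `ν`). [folklore] -/
theorem abs_RL_le (ν : ℝ) (y : 𝕋²) : |RL ν y| ≤ 2 :=
  (abs_modeSeries_le (summable_norm_zL ν) y).trans (tsum_norm_zL_le ν)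

/-- The Fourier coefficient of the response at the resonant frequency `k_n` is `z_n(ν)/2`. [folklore] -/
theorem mFourierCoeff_RL (ν : ℝ) (n : ℕ) :
    mFourierCoeff (fun y => ((RL ν y : ℝ) : ℂ)) (kL n) = zL ν n / 2 :=
  mFourierCoeff_modeSeries_eq (summable_norm_zL ν) kL_injective kL_ne_neg n

/-- **The steady drift–diffusion equation** `c·∇R_ν - νΔR_ν = h` (termwise: the symbol of
`c·∇ - νΔ` on `M_{k_n}` is `iσ_n + νλ_n`, and `(iσ_n + νλ_n) z_n(ν) = w_n`). [folklore] -/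
theorem drift_diffusion_RL {ν : ℝ} (hν : 0 < ν) (y : 𝕋²) :
    ⟪cL, gradient (RL ν) y⟫_ℝ - ν * laplacian (RL ν) y = hL y := by
  have hz := rapidDecay_zL hν
  have hR1 : IsContDiff 1 (RL ν) := (isSmooth_RL hν).isContDiff (by simp)
  have hsum1 : ∀ j : Fin 2, Summable fun n =>
      rmode (kL n) (2 * Real.pi * Complex.I * (kL n j) * zL ν n) y := fun j =>
    ((hz.summableLiftBounds.partialDeriv j).summable_apply y).congr fun n => partialDeriv_rmode _ _ _ _
  have hsumσ : Summable fun n => rmode (kL n) ((σL n : ℂ) * Complex.I * zL ν n) y := by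
    refine Summable.of_norm_bounded ((summable_norm_zL ν).mul_left (2 * Real.pi)) fun n => ?_
    refine (norm_rmode_le _ _ _).trans ?_
    rw [norm_mul, norm_mul, Complex.norm_I, mul_one, Complex.norm_real, Real.norm_eq_abs, abs_σL]
    have h1 := sL_lt_one n; have h2 := sL_pos n
    have : 2 * Real.pi * sL n ≤ 2 * Real.pi := by nlinarith [Real.pi_pos]
    exact mul_le_mul_of_nonneg_right this (norm_nonneg _)
  have hsum2 : Summable fun n => -(4 * Real.pi ^ 2 * freqNormSq (kL n)) * rmode (kL n) (zL ν n) y := by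
    refine Summable.of_norm_bounded ((hz 1).mul_left (2 * Real.pi)) fun n => ?_
    have hF := freqNormSq_nonneg (kL n)
    rw [norm_mul, norm_neg, Real.norm_eq_abs, abs_of_nonneg (by positivity), pow_one]
    calc 4 * Real.pi ^ 2 * freqNormSq (kL n) * ‖rmode (kL n) (zL ν n) y‖
        ≤ 4 * Real.pi ^ 2 * freqNormSq (kL n) * ‖zL ν n‖ :=
          mul_le_mul_of_nonneg_left (norm_rmode_le _ _ _) (by positivity)
      _ ≤ 2 * Real.pi * (‖zL ν n‖ * (2 * Real.pi * (1 + freqNormSq (kL n)))) := by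
          nlinarith [norm_nonneg (zL ν n), Real.pi_pos, mul_nonneg (norm_nonneg (zL ν n)) hF]
  rw [inner_gradient_eq_sum_mul_partialDeriv hR1]
  have hd : ∀ j, partialDeriv j (RL ν) y =
      ∑' n, rmode (kL n) (2 * Real.pi * Complex.I * (kL n j) * zL ν n) y :=
    fun j => hz.partialDeriv_modeSeries j y
  have hl : laplacian (RL ν) y = ∑' n, -(4 * Real.pi ^ 2 * freqNormSq (kL n)) * rmode (kL n) (zL ν n) y :=
    hz.laplacian_modeSeries y
  simp_rw [hd]
  rw [hl]
  have h1 : ∑ j, cL j * ∑' n, rmode (kL n) (2 * Real.pi * Complex.I * (kL n j) * zL ν n) y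
      = ∑' n, ∑ j, cL j * rmode (kL n) (2 * Real.pi * Complex.I * (kL n j) * zL ν n) y := by
    rw [Summable.tsum_finsetSum (fun j _ => (hsum1 j).mul_left (cL j))]
    simp_rw [tsum_mul_left]
  have h2 : ∀ n, ∑ j, cL j * rmode (kL n) (2 * Real.pi * Complex.I * (kL n j) * zL ν n) y
      = rmode (kL n) ((σL n : ℂ) * Complex.I * zL ν n) y := by
    intro n
    simp_rw [← rmode_ofReal_mul]
    rw [← rmode_sum]
    congr 1
    have h3 := sum_cL_mul_kL n
    calc ∑ j, (cL j : ℂ) * (2 * Real.pi * Complex.I * (kL n j) * zL ν n)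
        = (((∑ j, cL j * (kL n j : ℝ)) : ℝ) : ℂ) * (2 * Real.pi * Complex.I * zL ν n) := by
          push_cast
          rw [Finset.sum_mul]
          exact Finset.sum_congr rfl fun j _ => by ring
      _ = (σL n : ℂ) * Complex.I * zL ν n := by rw [h3, σL]; push_cast; ring
  rw [h1]
  simp_rw [h2]
  rw [← tsum_mul_left, ← (hsumσ).tsum_sub (hsum2.mul_left ν)]
  unfold hL modeSeries
  refine tsum_congr fun n => ?_
  show _ = rmode (kL n) (wL n : ℂ) y
  have h4 : ν * (-(4 * Real.pi ^ 2 * freqNormSq (kL n)) * rmode (kL n) (zL ν n) y) =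
      -rmode (kL n) (((ν * lamL n : ℝ) : ℂ) * zL ν n) y := by
    rw [rmode_ofReal_mul, lamL]; ring
  rw [h4, sub_neg_eq_add, ← rmode_add, ← den_mul_zL ν n]
  congr 1
  rw [den]; ring

/-- The constant planar drift is divergence free. [folklore] -/
theorem isDivFree_const_cL : IsDivFree (fun _ : 𝕋² => cL) := by
  intro y
  rw [divergence]
  refine Finset.sum_eq_zero fun i _ => ?_
  simp [Torus.partialDeriv, Torus.lineDeriv]

end Planar

/-! ## The three-dimensional steady states -/

section ThreeD

/-- The flat two-torus (local notation). -/
local notation "𝕋²" => UnitAddTorus (Fin 2)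
/-- `ℝ²` (local notation). -/
local notation "E²" => EuclideanSpace ℝ (Fin 2)
/-- The flat three-torus (local notation). -/
local notation "𝕋³" => UnitAddTorus (Fin 3)
/-- `ℝ³` (local notation). -/
local notation "E³" => EuclideanSpace ℝ (Fin 3)

/-- **The Liouville laminar states** `U_ν = (c, R_ν) ∘ π = (-θ, 1, R_ν(x₀,x₁))`. [folklore] -/
def UL (ν : ℝ) : 𝕋³ → E³ := twoHalf (fun _ => cL) (RL ν)

/-- **The force** `f = (0, 0, h(x₀,x₁))`, independent of `ν` and of time. [folklore] -/
def fL : 𝕋³ → E³ := twoHalf (fun _ => 0) hL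

/-- `f` is smooth. [folklore] -/
theorem isSmooth_fL : IsSmooth fL := (isSmooth_const (0 : E²)).twoHalf isSmooth_hL

/-- `f` is divergence free. [folklore] -/
theorem isDivFree_fL : IsDivFree fL := by
  refine IsDivFree.twoHalf (fun y => ?_) hL
  rw [divergence]
  refine Finset.sum_eq_zero fun i _ => ?_
  simp [Torus.partialDeriv, Torus.lineDeriv]

/-- `f` has zero mean. [folklore] -/
theorem hasZeroMean_fL : HasZeroMean fL :=
  Torus.hasZeroMean_twoHalf (integrable_const _) isSmooth_hL.continuous.integrable_unitAddTorus
    (by simp [HasZeroMean]) hasZeroMean_hL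

/-- `U_ν` is smooth (`ν > 0`). [folklore] -/
theorem isSmooth_UL {ν : ℝ} (hν : 0 < ν) : IsSmooth (UL ν) :=
  (isSmooth_const cL).twoHalf (isSmooth_RL hν)

/-- The `2½`-dimensional Navier–Stokes force of the ansatz `(V, R, φ) = (c, R_ν, 0)` is
`(0, h) ∘ π = f` (the planar part `∂ₜc + (c·∇)c - νΔc + ∇0` vanishes; the vertical part is the
drift–diffusion residual `c·∇R_ν - νΔR_ν = h`). [folklore] -/
theorem twoHalfForce_eq {ν : ℝ} (hν : 0 < ν) :
    Torus.twoHalfForce univ ν (fun _ _ => cL) (fun _ => RL ν) (fun _ _ => (0 : ℝ)) = fun _ => fL := by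
  funext t x
  rw [Torus.twoHalfForce_apply]
  simp only [fL, twoHalf]
  congr 1
  refine Prod.ext ?_ ?_
  · show Literature.Analysis.FunctionSpaces.Torus.timeDerivWithin univ (fun (_ : ℝ) (_ : 𝕋²) => cL) t
          (planarProj x) +
        Literature.Analysis.FunctionSpaces.Torus.convect (fun _ : 𝕋² => cL) (fun _ : 𝕋² => cL)
          (planarProj x) -
        ν • laplacian (fun _ : 𝕋² => cL) (planarProj x) +
        gradient (fun _ : 𝕋² => (0 : ℝ)) (planarProj x) = 0
    have h1 : Literature.Analysis.FunctionSpaces.Torus.timeDerivWithin univ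
        (fun (_ : ℝ) (_ : 𝕋²) => cL) t (planarProj x) = 0 := by
      simp [Literature.Analysis.FunctionSpaces.Torus.timeDerivWithin]
    have h2 : Literature.Analysis.FunctionSpaces.Torus.convect (fun _ : 𝕋² => cL) (fun _ : 𝕋² => cL)
        (planarProj x) = 0 := by
      have h : liftAt (fun _ : 𝕋² => cL) (planarProj x) = fun _ => cL := rfl
      simp only [Literature.Analysis.FunctionSpaces.Torus.convect, Torus.fderiv, h, fderiv_const_apply,
        zero_apply]
    have h3 : laplacian (fun _ : 𝕋² => cL) (planarProj x) = 0 := by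
      have h : liftAt (fun _ : 𝕋² => cL) (planarProj x) = fun _ => cL := rfl
      simp only [Torus.laplacian, h]
      rw [InnerProductSpace.laplacian_const]
      rfl
    have h4 : gradient (fun _ : 𝕋² => (0 : ℝ)) (planarProj x) = 0 :=
      gradient_fun_const (0 : E²) (0 : ℝ)
    rw [h1, h2, h3, h4, smul_zero]
    simp
  · show Literature.Analysis.FunctionSpaces.Torus.timeDerivWithin univ (fun (_ : ℝ) => RL ν) t
          (planarProj x) +
        ⟪cL, gradient (RL ν) (planarProj x)⟫_ℝ - ν * laplacian (RL ν) (planarProj x) =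
        hL (planarProj x)
    have h1 : Literature.Analysis.FunctionSpaces.Torus.timeDerivWithin univ (fun (_ : ℝ) => RL ν) t
        (planarProj x) = 0 := by
      simp [Literature.Analysis.FunctionSpaces.Torus.timeDerivWithin]
    rw [h1, zero_add, drift_diffusion_RL hν]

/-- **Exact steady solutions**: for every `ν > 0`, `U_ν` (with zero pressure) is a classical
solution of `NS_ν + f` on `ℝ × T³` with the SAME force `f`
(`Torus.isClassicalNSSolutionOn_twoHalf`). [cite: Cheskidov2023, §3 (3.12)–(3.13)] -/
theorem isClassicalNSSolutionOn_UL {ν : ℝ} (hν : 0 < ν) :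
    IsClassicalNSSolutionOn univ ν (fun _ => fL) (fun _ => UL ν)
      (fun _ => (fun _ : 𝕋² => (0 : ℝ)) ∘ planarProj) := by
  have h := Torus.isClassicalNSSolutionOn_twoHalf uniqueDiffOn_univ ν (V := fun _ _ => cL)
    (R := fun _ => RL ν) (φ := fun _ _ => (0 : ℝ))
    (isSmoothSpaceTimeOn_const (isSmooth_const cL) _) (isSmoothSpaceTimeOn_const (isSmooth_RL hν) _)
    (isSmoothSpaceTimeOn_const (isSmooth_const (0 : ℝ)) _) (fun _ _ => isDivFree_const_cL)
  rw [twoHalfForce_eq hν] at h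
  exact h

/-- **Bounded energy, uniformly in `ν`**: `‖U_ν(x)‖² = |c|² + R_ν(πx)² ≤ |c|² + 4`. [folklore] -/
theorem norm_sq_UL_le (ν : ℝ) (x : 𝕋³) : ‖UL ν x‖ ^ 2 ≤ ‖cL‖ ^ 2 + 4 := by
  rw [UL, norm_sq_twoHalf]
  have h := abs_RL_le ν (planarProj x)
  have h' : RL ν (planarProj x) ^ 2 ≤ 4 := by
    rw [← sq_abs]; nlinarith [abs_nonneg (RL ν (planarProj x))]
  linarith

/-- `∫ ‖U_ν‖² ≤ |c|² + 4` for every `ν > 0`. [folklore] -/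
theorem integral_norm_sq_UL_le {ν : ℝ} (hν : 0 < ν) : ∫ x, ‖UL ν x‖ ^ 2 ≤ ‖cL‖ ^ 2 + 4 := by
  have hc : Continuous (UL ν) := (isSmooth_UL hν).continuous
  calc ∫ x, ‖UL ν x‖ ^ 2 ≤ ∫ _ : 𝕋³, (‖cL‖ ^ 2 + 4) :=
        integral_mono (hc.norm.pow 2).integrable_unitAddTorus (integrable_const _)
          fun x => norm_sq_UL_le ν x
    _ = ‖cL‖ ^ 2 + 4 := by simp

/-- **Enstrophy from one resonant mode** (Bessel's inequality on `∂ⱼR_ν` at the frequency `k_n`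
and `𝓕(∂ⱼR)(k) = 2πi kⱼ R̂(k)`):
`π² b_n² |z_n(ν)|² ≤ π²|k_n|²|z_n(ν)|² ≤ ‖∇R_ν‖₂² ≤ ‖∇U_ν‖₂²`.
[cite: Grafakos2014, Prop. 3.2.6 (8), 3.2.7 (3)] -/
theorem enstrophy_ge {ν : ℝ} (hν : 0 < ν) (n : ℕ) :
    Real.pi ^ 2 * (bL n : ℝ) ^ 2 * ‖zL ν n‖ ^ 2 ≤ (eGradNormSq (UL ν)).toReal := by
  have hR := isSmooth_RL hν
  have h1 : Torus.scalarGradNormSq (RL ν) ≤ (eGradNormSq (UL ν)).toReal :=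
    Torus.scalarGradNormSq_le_toReal_eGradNormSq_twoHalf (isSmooth_const cL) hR
  refine le_trans ?_ h1
  rw [Torus.scalarGradNormSq_eq_sum_integral hR]
  have h2 : ∀ j : Fin 2, ‖mFourierCoeff (fun y => ((partialDeriv j (RL ν) y : ℝ) : ℂ)) (kL n)‖ ^ 2 ≤
      ∫ y, partialDeriv j (RL ν) y ^ 2 := fun j =>
    le_hasSum (hasSum_sq_norm_mFourierCoeff_ofReal ((hR.partialDeriv j).memLp 2)) (kL n)
      fun K _ => sq_nonneg _
  have h3 : ∀ j : Fin 2, mFourierCoeff (fun y => ((partialDeriv j (RL ν) y : ℝ) : ℂ)) (kL n) =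
      (2 * Real.pi * Complex.I * (kL n j : ℂ)) • (zL ν n / 2) := by
    intro j
    have h := mFourierCoeff_partialDeriv hR.ofReal_comp j (kL n)
    rw [mFourierCoeff_RL] at h
    rw [← h]
    congr 1
    funext y
    exact (partialDeriv_ofReal_comp hR j y).symm
  calc Real.pi ^ 2 * (bL n : ℝ) ^ 2 * ‖zL ν n‖ ^ 2
      ≤ Real.pi ^ 2 * freqNormSq (kL n) * ‖zL ν n‖ ^ 2 := by
        have := bL_sq_le_freqNormSq n
        have : 0 ≤ Real.pi ^ 2 * ‖zL ν n‖ ^ 2 := by positivity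
        nlinarith
    _ = ∑ j : Fin 2, ‖(2 * Real.pi * Complex.I * (kL n j : ℂ)) • (zL ν n / 2)‖ ^ 2 := by
        simp_rw [norm_sq_coeff]
        rw [freqNormSq, Finset.mul_sum, Finset.sum_mul]
    _ ≤ ∑ j : Fin 2, ∫ y, partialDeriv j (RL ν) y ^ 2 :=
        Finset.sum_le_sum fun j _ => by rw [← h3 j]; exact h2 j

/-- At the resonant viscosity the `n`-th response has `|z_n|² = 4^{-n}/2`. [folklore] -/
theorem norm_sq_zL_νL (n : ℕ) : ‖zL (νL n) n‖ ^ 2 = ((1 / 2 : ℝ) ^ n) ^ 2 / 2 := by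
  have hσ := σL_ne_zero n
  have hden : ‖den (νL n) n‖ ^ 2 = 2 * σL n ^ 2 := by
    rw [Complex.sq_norm, Complex.normSq_apply, den_re, den_im, νL,
      div_mul_cancel₀ _ (lamL_pos n).ne', ← pow_two, ← pow_two, sq_abs]
    ring
  rw [zL, norm_div, div_pow, hden, Complex.norm_real, Real.norm_eq_abs, abs_of_pos (wL_pos n),
    wL_eq, mul_pow, sq_abs]
  field_simp

/-- **Unbounded enstrophy along the resonant sequence**: `‖∇U_{ν_n}‖₂² ≥ 8π² 4ⁿ → ∞`. [folklore] -/
theorem enstrophy_νL_ge (n : ℕ) :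
    8 * Real.pi ^ 2 * (4 : ℝ) ^ n ≤ (eGradNormSq (UL (νL n))).toReal := by
  refine le_trans ?_ (enstrophy_ge (νL_pos n) n)
  rw [norm_sq_zL_νL]
  have h1 := four_pow_le_bL n
  have h2 : ((4 : ℝ) ^ (n + 1)) ^ 2 ≤ (bL n : ℝ) ^ 2 := pow_le_pow_left₀ (by positivity) h1 2
  have h3 : (4 : ℝ) ^ n * ((1 / 2 : ℝ) ^ n) ^ 2 = 1 := by
    rw [← pow_mul, mul_comm n 2, pow_mul, ← mul_pow]; norm_num
  have h4 : ((4 : ℝ) ^ (n + 1)) ^ 2 = 16 * (4 : ℝ) ^ n * (4 : ℝ) ^ n := by ring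
  calc 8 * Real.pi ^ 2 * (4 : ℝ) ^ n
      = Real.pi ^ 2 * ((4 : ℝ) ^ (n + 1)) ^ 2 * (((1 / 2 : ℝ) ^ n) ^ 2 / 2) := by
        rw [h4]; linear_combination (-(8 * Real.pi ^ 2 * (4 : ℝ) ^ n)) * h3
    _ ≤ Real.pi ^ 2 * (bL n : ℝ) ^ 2 * (((1 / 2 : ℝ) ^ n) ^ 2 / 2) :=
        mul_le_mul_of_nonneg_right (mul_le_mul_of_nonneg_left h2 (by positivity)) (by positivity)

/-- `‖∇U_{ν_n}‖₂² → ∞`. [folklore] -/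
theorem tendsto_enstrophy : Tendsto (fun n => (eGradNormSq (UL (νL n))).toReal) atTop atTop := by
  refine tendsto_atTop_mono enstrophy_νL_ge ?_
  exact (tendsto_pow_atTop_atTop_of_one_lt (by norm_num : (1 : ℝ) < 4)).const_mul_atTop
    (by positivity)

/-! ## Main theorems -/

/-- **Unbounded enstrophy at bounded energy under ONE smooth force (steady states).**  There
are a smooth, divergence-free, mean-zero force `f` on `T³`, viscosities `ν_n > 0` with
`ν_n → 0`, and smooth steady classical solutions `(U_n, P_n)` of the Navier–Stokes system with
viscosity `ν_n` and force `f` (as time-independent classical solutions on `ℝ × T³`) with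
`sup_n ∫‖U_n‖² < ∞` and `‖∇U_n‖₂² → ∞` (spectral `Torus.eGradNormSq`).  The states are the
laminar Liouville states `U_n = (c, R_{ν_n}) ∘ π`; nothing turbulent happens. [folklore] -/
theorem exists_steadyStates_unboundedEnstrophy :
    ∃ f : 𝕋³ → E³, IsSmooth f ∧ IsDivFree f ∧ HasZeroMean f ∧
      ∃ (ν : ℕ → ℝ) (U : ℕ → 𝕋³ → E³) (P : ℕ → 𝕋³ → ℝ),
        (∀ n, 0 < ν n) ∧ Tendsto ν atTop (𝓝 0) ∧
        (∀ n, IsClassicalNSSolutionOn univ (ν n) (fun _ => f) (fun _ => U n) (fun _ => P n)) ∧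
        (∃ E : ℝ, ∀ n, ∫ x, ‖U n x‖ ^ 2 ≤ E) ∧
        Tendsto (fun n => (eGradNormSq (U n)).toReal) atTop atTop :=
  ⟨fL, isSmooth_fL, isDivFree_fL, hasZeroMean_fL, νL, fun n => UL (νL n),
    fun _ => (fun _ : 𝕋² => (0 : ℝ)) ∘ planarProj, νL_pos, tendsto_νL,
    fun n => isClassicalNSSolutionOn_UL (νL_pos n), ⟨_, fun n => integral_norm_sq_UL_le (νL_pos n)⟩,
    tendsto_enstrophy⟩

/-- **Unbounded mean enstrophy at bounded mean energy (zeroth-law vocabulary).**  In the exact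
vocabulary of `AnomalousDissipation` / `Literature.Turb.ZerothLaw` — one smooth steady force,
`ν_j → 0`, global Leray–Hopf solutions, `sup_j meanEnergy < ∞` — the necessary condition
`meanDissipation(ν_j, u_j)/ν_j = ⟨‖∇u_j‖₂²⟩ → ∞` for the zeroth law is realised by laminar steady
states (whose `meanDissipation` itself tends to `0`).  Hence "unbounded mean enstrophy at bounded
mean energy" carries no information towards the summit. [folklore] -/
theorem exists_lerayHopf_unboundedMeanEnstrophy :
    ∃ f : 𝕋³ → E³, IsSmooth f ∧ IsDivFree f ∧ HasZeroMean f ∧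
      ∃ (ν : ℕ → ℝ) (u₀ : ℕ → 𝕋³ → E³) (u : ℕ → ℝ → 𝕋³ → E³),
        (∀ j, 0 < ν j) ∧ Tendsto ν atTop (𝓝 0) ∧
        (∀ j, Torus.IsGlobalLerayHopf (ν j) (fun _ => f) (u₀ j) (u j)) ∧
        (∃ E : ℝ, ∀ j, meanEnergy (u j) ≤ E) ∧
        Tendsto (fun j => meanDissipation (ν j) (u j) / ν j) atTop atTop := by
  obtain ⟨f, hf, hdiv, hmean, ν, U, P, hν, hν0, hsol, ⟨E, hE⟩, hgrow⟩ :=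
    exists_steadyStates_unboundedEnstrophy
  refine ⟨f, hf, hdiv, hmean, ν, U, fun n _ => U n, hν, hν0, fun n => (hsol n).isGlobalLerayHopf,
    ⟨E, fun n => ?_⟩, ?_⟩
  · rw [meanEnergy_eq_longTimeAvgSup, longTimeAvgSup_of_eq_const fun t _ => rfl]
    exact hE n
  · refine (tendsto_congr fun n => ?_).2 hgrow
    unfold meanDissipation
    rw [longTimeAvgSup_of_eq_const fun t _ => rfl, mul_div_cancel_left₀ _ (hν n).ne']

end ThreeD

end Summit.AnomalousDissipation.AnomalousDissipation.Theorems

end
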